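import Literature.MathematicalPhysics.QuantumFieldTheory.Balaban1983to89.Step
import Literature.MathematicalPhysics.QuantumFieldTheory.Balaban1983to89.T4CauchySum

/-!
# T4TubeBudget — the tube-budget arithmetic of node O3b (cell `pub-balaban`, T4-DAG v3 §5 row T4-O3b.B; bookkeeping)

HONEST FRAMING (cell `pub-balaban`, T4-DAG PAGE 1).  The cell's T4 target is the existence AND uniqueness of the
continuum limit of Bałaban's unit-scale averaged loop expectations on a finite torus — a constructive-QFT statement
strictly beyond ultraviolet stability ([Balaban1989LargeFieldII] Thm 1 p. 355); it is NOT the Yang–Mills mass gap and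
NOT the Clay problem.  This module is the KERNEL ARITHMETIC of the cell's located budget (TOB-k) of node O3b (referee
record `t4/T4-REF-O3.md` v1, V2 (c) / V3 / V5 (iv) — a cell ANALYSIS, NOT in print): the necessary per-cube budget that
any class of tube-attached exponent terms measured in factor format must meet at the per-point loci of the cluster
expansion, and its two model evaluations — the RATE branch passes K-uniformly under `L⁴θ₁² ≤ 1`, `L⁴θ₁φ ≤ 1` and
summable birth-scale weights; the OSCILLATION branch fails (the budget is unbounded in the number of steps K) as soon
as `L⁴θ > 1` and the weights decay only polynomially in the number of remaining scales.  It asserts NOTHING about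
Bałaban's renormalization-group objects: `TubeBudget` is a HYPOTHESIS SHAPE over abstract real arrays (sizes
`s j k`, weights `w j`), the one tree predicate consumed, `Step.Discrete031 b β' K g gs` (the endpoint running (0.31) of
[Balaban1987RG1] in the tree's per-step normalisation), enters §4 as a HYPOTHESIS on an abstract sequence `gs` (cell
flag COND-BetaPertH) and only its UPPER half is used there; every theorem is elementary real analysis (finite sums,
geometric versus polynomial growth, `Real.log`).  Value = kernel bookkeeping of an implication ⇐ named inputs; NOT
summit progress.

Printed context (verbatim, page-cited, read on the journal page images; the manuscripts under audit are quoted for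
CONTEXT only — no disputed step of theirs is used anywhere below).  The printed bookkeeping whose tube analogue (TOB-k)
is: [Balaban1988Convergent] p. 260, after "(2.31)": "Here κ_0 can be chosen arbitrarily large, similarly as κ, if the
other parameters are fixed properly, as in [I]." … "After the vacuum energy renormalization we obtain a sum of marginal
terms, i.e., terms with bounds O(1)(L^jη)^4 g_j^{κ_0} exp(−κd_j(X)). The sum over X is controlled by the exponential
factor, and by the factor (L^jη)^4. The sum over j is controlled by g_j^{κ_0}." — positional count of scale-j domains
against the small factor per domain, summed over the scales; and the printed growth of the radii along the flow,
[Balaban1988Convergent] p. 255: "R_j is the smallest number of the form L^r such, that R_j ≥ (log g_j^{−2})^r . (2.5)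
The coupling constants g_j satisfy the inequalities g_n ≤ (1 + g_n² β′(n−m))^{1/2} g_m ≤ …" (2.6) — so `log g_j⁻²`,
hence `R_j`, grows only polylogarithmically in the number of remaining scales, which is what §4 weighs against a
geometric factor.  [cite: Balaban1988Convergent, (2.31) p.260; (2.5)–(2.6) p.255]
How the cell uses them (T4-REF-O3 v1 V2 (c), the cell's ANALYSIS, not in print): for every scale `k ≤ K` and every tube
M-cube at scale k, `Σ_{j ≤ k} w_j · s_j^{(k)} ≤ c₀·α₄` — (TOB-k) — where `s_j^{(k)}` is the size the format proves AT
SCALE k for the terms born at scale j and felt at the cube (positional count of birth places under the cube included)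
and `w_j = g_j^{κ₀′}`-type weights (V5 (iv): `g_j^{κ₀+2} R_j²`).  Model evaluations: (TOB′)/V3 — oscillation-type
sizes `(L⁴θ)^{K−j}` with `L⁴θ > 1` against weights decaying like a power of `(K − j)`: DIVERGENT in K; V5 (iv) —
moment-type sizes, count `L^{4(k−j)}` times `θ₁^{2(K−j)}` (second order) or `(θ₁φ)^{K−j}` (first order): bounded
uniformly in K and k iff `L⁴θ₁² ≤ 1`, `L⁴θ₁φ ≤ 1`, given summable weights.

What is proved (all [folklore]; at fixed final scale `K`, `j` = birth scale, `k` = current scale, `j ≤ k ≤ K`; the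
truncated subtractions `k - j`, `K - j`, `K - k` occur only under these binders, where they are exact).
§1 `TubeBudget K w s c := ∀ k ≤ K, Σ_{j ≤ k} w j · s j k ≤ c` and its algebra: monotone in `c` and in the sizes,
   additive in the sizes ("sizes add, budgets add" — the shape row O3.E-iii-c needs), homogeneous, `0 ≤ c` forced when
   weights and sizes are nonnegative.
§2 RATE BRANCH (row text (b1) `tubeBudget_of_sqRate`): if `s j k ≤ A · Λ^{k−j} · τ^{K−j}` with `Λ, τ ≥ 0`, `τ ≤ 1`,
   `Λτ ≤ 1` (count `Λ = L⁴` per remaining scale under the cube, per-term rate `τ = θ₁²` resp. `θ₁φ`), nonnegative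
   weights with `Σ_{j ≤ K} w j ≤ W`, then `TubeBudget K w s (A·W)` (`tubeBudget_of_rate`; the split
   `Λ^{k−j} τ^{K−j} = (Λτ)^{k−j} τ^{K−k} ≤ 1` is `count_mul_rate_le_one`); the two-part NE1′ instance with `Λ = L⁴`,
   `L ≥ 1`, `L⁴θ₁² ≤ 1`, `L⁴θ₁φ ≤ 1` (`tubeBudget_of_sqRate`); weights dominated by a summable profile of the remaining
   scales, `0 ≤ w j ≤ ω(K − j)`, have `Σ_{j ≤ K} w j ≤ Σ' ω` for every K (`sum_weights_le_tsum`), whence the K-UNIFORM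
   budget `A · Σ' ω` for K-indexed families (`tubeBudget_uniform`).
§3 OSCILLATION BRANCH FAILS (row text (b2) `not_tubeBudget_of_osc`): if at the final scale the sizes dominate
   `a (Λθ)^{K−j}` (`a > 0`, `Λθ > 1`) and the weights dominate `b / ((K−j)+1)^p` (`b > 0`, any `p : ℕ`), all entries
   nonnegative, then for every `c` some `K` violates `TubeBudget K (w K) (s K) c` — already the terms born at the first
   scale do: `(Λθ)^K / (K+1)^p → ∞` (`tendsto_succ_pow_div_pow_of_one_lt`, from Mathlib's
   `tendsto_pow_const_div_const_pow_of_one_lt`).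
§4 POLYLOG RADII versus GEOMETRIC DECAY (row text (b3) `sup_pow_mul_geom_le`, shared with row O4.K): for `0 ≤ θ < 1`
   and `q : ℕ`, `(n+1)^q θ^n ≤ C_q(θ) := Σ' m, (m+1)^q θ^m` for all n (`succ_pow_mul_geom_le`, via
   `T4CauchySum.summable_succ_pow_mul_geometric`); hence radii with a polynomial profile in the remaining scales,
   `0 ≤ R j ≤ A ((K−j)+1)^r`, satisfy `R j ^ 4 · θ^{K−j} ≤ A⁴ · C_{4r}(θ)` uniformly in `K`, `j` (`radius_pow_mul_geom_le`);
   and the polylogarithmic radii of (2.5) have such a profile under the UPPER half of `Step.Discrete031`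
   (`1/gs_j² ≤ 1/g² + β'(K−j)`, so `log gs_j⁻² ≤ (1/g² + β')((K−j)+1)`; `log_inv_sq_le_of_discrete031`,
   `radius_profile_of_discrete031`, `radius_pow_mul_geom_le_of_discrete031`).

Deliberately NOT here: any statement about D-terms, dressed observables, exponent-term classes or activities of
Bałaban's expansions (the sizes `s` and weights `w` are abstract; that NE1′-type sizes hold is the cell's OPEN new
estimate NE1′, rows O3.E-i′, O3.E-ii, O3.E-iii; that (TOB-k) is the right budget is the referee ANALYSIS T4-REF-O3 V2 (c), not a
theorem); the summability of the coupling weights `g_j^{κ₀+2} R_j²` along (0.31) (V5 (iv): true for `κ₀ > 0` — a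
`Real.log`/`Real.rpow` comparison left to the consumer rows O3.E-iii-b / O4.K; here it is the hypothesis `Summable ω`);
the existence of coupling sequences obeying (0.31) (tree `B12Beta`, `Beta.*`, COND-BetaPertH); the link
`B14.IsRj ⇒ R_j ≤ max(1, L (log g_j⁻²)^r)` (row O4.K).  Imports: `Step` (for the predicate `Step.Discrete031` only) and
`T4CauchySum` (for `summable_succ_pow_mul_geometric`).
-/

namespace Literature.MathematicalPhysics.QuantumFieldTheory.Balaban1983to89.T4TubeBudget

open Finset Filter Topology

/-! ## §1 The budget predicate (TOB-k) and its algebra -/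

/-- HYPOTHESIS SHAPE — THE TUBE BUDGET (TOB-k) AT FINAL SCALE `K` (cell analysis T4-REF-O3 v1 V2 (c), NOT PRINTED):
for every current scale `k ≤ K`, the weighted sum over birth scales `j ≤ k` of the sizes `s j k` felt at a tube cube of
scale `k` is at most `c`.  `w j` = weight of birth scale `j` (a power of the running coupling, possibly times `R_j²`),
`s j k` = per-cube size at scale `k` of the terms born at scale `j` (positional count included); both are abstract real
arrays "at this K".  Printed model of the count-versus-small-factor bookkeeping: p. 260 of [Balaban1988Convergent],
*"The sum over X is controlled by the exponential factor, and by the factor (L^jη)^4. The sum over j is controlled by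
g_j^{κ_0}."* [cite: Balaban1988Convergent, (2.31) p.260] -/
def TubeBudget (K : ℕ) (w : ℕ → ℝ) (s : ℕ → ℕ → ℝ) (c : ℝ) : Prop :=
  ∀ k ≤ K, ∑ j ∈ range (k + 1), w j * s j k ≤ c

/-- Unfolding. [folklore] -/
theorem tubeBudget_iff {K : ℕ} {w : ℕ → ℝ} {s : ℕ → ℕ → ℝ} {c : ℝ} :
    TubeBudget K w s c ↔ ∀ k ≤ K, ∑ j ∈ range (k + 1), w j * s j k ≤ c :=
  Iff.rfl

namespace TubeBudget

variable {K : ℕ} {w : ℕ → ℝ} {s s₁ s₂ : ℕ → ℕ → ℝ} {c c₁ c₂ : ℝ}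

/-- Monotone in the budget constant. [folklore] -/
theorem mono (h : TubeBudget K w s c₁) (hc : c₁ ≤ c₂) : TubeBudget K w s c₂ :=
  fun k hk => (h k hk).trans hc

/-- Monotone in the sizes (nonnegative weights): smaller sizes meet the same budget. [folklore] -/
theorem of_le (h : TubeBudget K w s₂ c) (hw : ∀ j ≤ K, 0 ≤ w j)
    (hs : ∀ k ≤ K, ∀ j ≤ k, s₁ j k ≤ s₂ j k) : TubeBudget K w s₁ c := by
  intro k hk
  refine le_trans (sum_le_sum fun j hj => ?_) (h k hk)
  have hjk : j ≤ k := Nat.lt_succ_iff.mp (mem_range.mp hj)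
  exact mul_le_mul_of_nonneg_left (hs k hk j hjk) (hw j (hjk.trans hk))

/-- "Sizes add, budgets add" (the shape row O3.E-iii-c consumes). [folklore] -/
theorem add (h₁ : TubeBudget K w s₁ c₁) (h₂ : TubeBudget K w s₂ c₂) :
    TubeBudget K w (fun j k => s₁ j k + s₂ j k) (c₁ + c₂) := by
  intro k hk
  have e : ∑ j ∈ range (k + 1), w j * (s₁ j k + s₂ j k)
      = ∑ j ∈ range (k + 1), w j * s₁ j k + ∑ j ∈ range (k + 1), w j * s₂ j k := by
    rw [← sum_add_distrib]
    exact sum_congr rfl fun j _ => by ring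
  rw [e]
  exact add_le_add (h₁ k hk) (h₂ k hk)

/-- Homogeneity: scaling the sizes by `a ≥ 0` scales the budget. [folklore] -/
theorem smul {a : ℝ} (ha : 0 ≤ a) (h : TubeBudget K w s c) :
    TubeBudget K w (fun j k => a * s j k) (a * c) := by
  intro k hk
  have e : ∑ j ∈ range (k + 1), w j * (a * s j k) = a * ∑ j ∈ range (k + 1), w j * s j k := by
    rw [mul_sum]
    exact sum_congr rfl fun j _ => by ring
  rw [e]
  exact mul_le_mul_of_nonneg_left (h k hk) ha

/-- With nonnegative weights and sizes the budget constant is forced to be nonnegative (no vacuous instance with a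
negative budget). [folklore] -/
theorem budget_nonneg (h : TubeBudget K w s c) (hw : ∀ j ≤ K, 0 ≤ w j)
    (hs : ∀ k ≤ K, ∀ j ≤ k, 0 ≤ s j k) : 0 ≤ c :=
  le_trans (sum_nonneg fun j hj => by
    have hj0 : j ≤ 0 := Nat.lt_succ_iff.mp (mem_range.mp hj)
    exact mul_nonneg (hw j (hj0.trans (Nat.zero_le K))) (hs 0 (Nat.zero_le K) j hj0)) (h 0 (Nat.zero_le K))

end TubeBudget

/-- The zero sizes meet the zero budget (the shape is inhabited non-trivially only through §2). [folklore] -/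
theorem tubeBudget_zero (K : ℕ) (w : ℕ → ℝ) : TubeBudget K w (fun _ _ => 0) 0 := by
  intro k _
  simp

/-! ## §2 The rate branch: count `Λ^{k−j}` against the per-term rate `τ^{K−j}` -/

/-- The split of the exponents under `j ≤ k ≤ K`: `Λ^{k−j} τ^{K−j} = (Λτ)^{k−j} τ^{K−k} ≤ 1` for `Λ, τ ≥ 0`, `τ ≤ 1`,
`Λτ ≤ 1`. [folklore] -/
theorem count_mul_rate_le_one {Λ τ : ℝ} (hΛ : 0 ≤ Λ) (hτ0 : 0 ≤ τ) (hτ1 : τ ≤ 1) (hΛτ : Λ * τ ≤ 1)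
    {j k K : ℕ} (hjk : j ≤ k) (hkK : k ≤ K) : Λ ^ (k - j) * τ ^ (K - j) ≤ 1 := by
  have e : K - j = (k - j) + (K - k) := by omega
  rw [e, pow_add, ← mul_assoc, ← mul_pow]
  exact mul_le_one₀ (pow_le_one₀ (mul_nonneg hΛ hτ0) hΛτ) (pow_nonneg hτ0 _) (pow_le_one₀ hτ0 hτ1)

/-- Partial sums of nonnegative weights are monotone in the range. [folklore] -/
theorem sum_weights_mono {w : ℕ → ℝ} {k K : ℕ} (hkK : k ≤ K) (hw : ∀ j ≤ K, 0 ≤ w j) :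
    ∑ j ∈ range (k + 1), w j ≤ ∑ j ∈ range (K + 1), w j :=
  sum_le_sum_of_subset_of_nonneg
    (fun _ hj => mem_range.mpr (lt_of_lt_of_le (mem_range.mp hj) (Nat.succ_le_succ hkK)))
    fun j hj _ => hw j (Nat.lt_succ_iff.mp (mem_range.mp hj))

/-- **THE RATE BRANCH** (T4-REF-O3 V5 (iv), one part): sizes `s j k ≤ A Λ^{k−j} τ^{K−j}` with `Λ, τ ≥ 0`, `τ ≤ 1`,
`Λτ ≤ 1`, `A ≥ 0`, nonnegative weights with total `≤ W`, give the budget `A · W` at every current scale `k ≤ K`.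
[folklore] -/
theorem tubeBudget_of_rate {K : ℕ} {w : ℕ → ℝ} {s : ℕ → ℕ → ℝ} {A Λ τ W : ℝ} (hw : ∀ j ≤ K, 0 ≤ w j)
    (hW : ∑ j ∈ range (K + 1), w j ≤ W) (hA : 0 ≤ A) (hΛ : 0 ≤ Λ) (hτ0 : 0 ≤ τ) (hτ1 : τ ≤ 1)
    (hΛτ : Λ * τ ≤ 1) (hs : ∀ k ≤ K, ∀ j ≤ k, s j k ≤ A * Λ ^ (k - j) * τ ^ (K - j)) :
    TubeBudget K w s (A * W) := by
  intro k hk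
  calc ∑ j ∈ range (k + 1), w j * s j k ≤ ∑ j ∈ range (k + 1), w j * A := by
        refine sum_le_sum fun j hj => ?_
        have hjk : j ≤ k := Nat.lt_succ_iff.mp (mem_range.mp hj)
        refine mul_le_mul_of_nonneg_left ((hs k hk j hjk).trans ?_) (hw j (hjk.trans hk))
        have h1 := count_mul_rate_le_one hΛ hτ0 hτ1 hΛτ hjk hk
        calc A * Λ ^ (k - j) * τ ^ (K - j) = A * (Λ ^ (k - j) * τ ^ (K - j)) := by ring
          _ ≤ A * 1 := mul_le_mul_of_nonneg_left h1 hA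
          _ = A := mul_one A
    _ = A * ∑ j ∈ range (k + 1), w j := by rw [mul_sum]; exact sum_congr rfl fun j _ => mul_comm _ _
    _ ≤ A * ∑ j ∈ range (K + 1), w j := mul_le_mul_of_nonneg_left (sum_weights_mono hk hw) hA
    _ ≤ A * W := mul_le_mul_of_nonneg_left hW hA

/-- **THE NE1′ INSTANCE** (row text (b1); T4-REF-O3 V5 (iv), cell analysis, NOT PRINTED): with `L ≥ 1`, count `L⁴`
per remaining scale under the cube, second-order sizes `A₂ (L⁴)^{k−j} (θ₁²)^{K−j}` and first-order sizes
`A₁ (L⁴)^{k−j} (θ₁φ)^{K−j}` (`θ₁, φ ≥ 0`), the two conditions `L⁴θ₁² ≤ 1`, `L⁴θ₁φ ≤ 1` and weights of total `≤ W`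
give the budget `(A₂ + A₁) · W` at every `k ≤ K`.  (With `φ = L⁻²`: `θ₁ = L⁻³` passes with room, `θ₁ = L⁻²` at
equality — V5 (iv).) [folklore] -/
theorem tubeBudget_of_sqRate {K : ℕ} {w : ℕ → ℝ} {s : ℕ → ℕ → ℝ} {A₁ A₂ L θ₁ φ W : ℝ}
    (hw : ∀ j ≤ K, 0 ≤ w j) (hW : ∑ j ∈ range (K + 1), w j ≤ W) (hA₁ : 0 ≤ A₁) (hA₂ : 0 ≤ A₂) (hL : 1 ≤ L)
    (hθ₁ : 0 ≤ θ₁) (hφ : 0 ≤ φ) (h2 : L ^ 4 * θ₁ ^ 2 ≤ 1) (h1 : L ^ 4 * (θ₁ * φ) ≤ 1)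
    (hs : ∀ k ≤ K, ∀ j ≤ k, s j k ≤
      A₂ * (L ^ 4) ^ (k - j) * (θ₁ ^ 2) ^ (K - j) + A₁ * (L ^ 4) ^ (k - j) * (θ₁ * φ) ^ (K - j)) :
    TubeBudget K w s ((A₂ + A₁) * W) := by
  have hL4 : 1 ≤ L ^ 4 := one_le_pow₀ hL
  have hΛ : 0 ≤ L ^ 4 := zero_le_one.trans hL4
  -- from `Λ ≥ 1` and `Λτ ≤ 1` the rate itself is `≤ 1`
  have le_one_of : ∀ {τ : ℝ}, 0 ≤ τ → L ^ 4 * τ ≤ 1 → τ ≤ 1 := fun {τ} hτ h =>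
    le_trans (by simpa using mul_le_mul_of_nonneg_right hL4 hτ) h
  have hB₂ : TubeBudget K w (fun j k => A₂ * (L ^ 4) ^ (k - j) * (θ₁ ^ 2) ^ (K - j)) (A₂ * W) :=
    tubeBudget_of_rate hw hW hA₂ hΛ (pow_nonneg hθ₁ 2) (le_one_of (pow_nonneg hθ₁ 2) h2) h2 fun _ _ _ _ => le_rfl
  have hB₁ : TubeBudget K w (fun j k => A₁ * (L ^ 4) ^ (k - j) * (θ₁ * φ) ^ (K - j)) (A₁ * W) :=
    tubeBudget_of_rate hw hW hA₁ hΛ (mul_nonneg hθ₁ hφ) (le_one_of (mul_nonneg hθ₁ hφ) h1) h1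
      fun _ _ _ _ => le_rfl
  have h := hB₂.add hB₁
  rw [add_mul]
  exact h.of_le hw hs

/-- **WEIGHTS DOMINATED BY A SUMMABLE PROFILE OF THE REMAINING SCALES**: if `0 ≤ w j ≤ ω(K − j)` for `j ≤ K` with `ω`
nonnegative and summable, then `Σ_{j ≤ K} w j ≤ Σ' n, ω n` — a bound uniform in `K` (V5 (iv): "given
Σ_j g_j^{κ₀+2} R_j² < ∞"; for the running couplings `ω` is a function of the number `K − j` of remaining scales).
[folklore] -/
theorem sum_weights_le_tsum {K : ℕ} {w ω : ℕ → ℝ} (hω : Summable ω) (hω0 : ∀ n, 0 ≤ ω n)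
    (hw : ∀ j ≤ K, w j ≤ ω (K - j)) : ∑ j ∈ range (K + 1), w j ≤ ∑' n, ω n := by
  calc ∑ j ∈ range (K + 1), w j ≤ ∑ j ∈ range (K + 1), ω (K - j) :=
        sum_le_sum fun j hj => hw j (Nat.lt_succ_iff.mp (mem_range.mp hj))
    _ = ∑ n ∈ range (K + 1), ω n := by
        have h := sum_range_reflect ω (K + 1)
        simpa using h
    _ ≤ ∑' n, ω n := hω.sum_le_tsum _ fun n _ => hω0 n

/-- **THE K-UNIFORM BUDGET** (row text (b1): "Summable w ⇒ sup_K sup_k budget ≤ C"): for K-indexed families of weights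
dominated by one summable profile of the remaining scales and sizes of the rate shape with `Λτ ≤ 1`, `τ ≤ 1`, the SAME
constant `A · Σ' ω` is a tube budget at every final scale `K` (and every `k ≤ K`). [folklore] -/
theorem tubeBudget_uniform {w : ℕ → ℕ → ℝ} {s : ℕ → ℕ → ℕ → ℝ} {ω : ℕ → ℝ} {A Λ τ : ℝ} (hω : Summable ω)
    (hω0 : ∀ n, 0 ≤ ω n) (hw0 : ∀ K, ∀ j ≤ K, 0 ≤ w K j) (hw : ∀ K, ∀ j ≤ K, w K j ≤ ω (K - j)) (hA : 0 ≤ A)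
    (hΛ : 0 ≤ Λ) (hτ0 : 0 ≤ τ) (hτ1 : τ ≤ 1) (hΛτ : Λ * τ ≤ 1)
    (hs : ∀ K, ∀ k ≤ K, ∀ j ≤ k, s K j k ≤ A * Λ ^ (k - j) * τ ^ (K - j)) :
    ∀ K, TubeBudget K (w K) (s K) (A * ∑' n, ω n) := fun K =>
  tubeBudget_of_rate (hw0 K) (sum_weights_le_tsum hω hω0 (hw K)) hA hΛ hτ0 hτ1 hΛτ (hs K)

/-! ## §3 The oscillation branch fails: geometric growth beats polynomial weights -/

/-- `(n+1)^p / x^n → 0` for `x > 1` (shift of Mathlib's `tendsto_pow_const_div_const_pow_of_one_lt`). [folklore] -/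
theorem tendsto_succ_pow_div_pow_of_one_lt (p : ℕ) {x : ℝ} (hx : 1 < x) :
    Tendsto (fun n : ℕ => ((n : ℝ) + 1) ^ p / x ^ n) atTop (𝓝 0) := by
  have hx0 : 0 < x := zero_lt_one.trans hx
  have h := ((tendsto_pow_const_div_const_pow_of_one_lt p hx).comp (tendsto_add_atTop_nat 1)).const_mul x
  rw [mul_zero] at h
  refine h.congr fun n => ?_
  simp only [Function.comp_apply, Nat.cast_add, Nat.cast_one, pow_succ]
  field_simp

/-- For `x > 1`, `a, b > 0` and any exponent `p`, the quantity `b/(K+1)^p · (a x^K)` exceeds every constant for some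
`K`. [folklore] -/
theorem exists_weight_mul_size_gt {x a b : ℝ} (p : ℕ) (hx : 1 < x) (ha : 0 < a) (hb : 0 < b) (c : ℝ) :
    ∃ K : ℕ, c < b / ((K : ℝ) + 1) ^ p * (a * x ^ K) := by
  have hx0 : 0 < x := zero_lt_one.trans hx
  rcases le_or_gt c 0 with hc | hc
  · exact ⟨0, lt_of_le_of_lt hc (by positivity)⟩
  · have hε : 0 < a * b / c := by positivity
    obtain ⟨K, hK⟩ := ((tendsto_succ_pow_div_pow_of_one_lt p hx).eventually (Iio_mem_nhds hε)).exists
    have hg0 : 0 < ((K : ℝ) + 1) ^ p / x ^ K := by positivity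
    have hK' : ((K : ℝ) + 1) ^ p / x ^ K < a * b / c := hK
    refine ⟨K, ?_⟩
    have h1 : c * (((K : ℝ) + 1) ^ p / x ^ K) < a * b := by
      have := mul_lt_mul_of_pos_left hK' hc
      rwa [mul_div_cancel₀ _ hc.ne'] at this
    have h2 : c < a * b / (((K : ℝ) + 1) ^ p / x ^ K) := (lt_div_iff₀ hg0).mpr h1
    have e : a * b / (((K : ℝ) + 1) ^ p / x ^ K) = b / ((K : ℝ) + 1) ^ p * (a * x ^ K) := by
      field_simp
    rwa [e] at h2

/-- **THE OSCILLATION BRANCH FAILS** (row text (b2); T4-REF-O3 V3 / (TOB′), cell analysis, NOT PRINTED): for K-indexed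
families with nonnegative entries, sizes at the final scale dominating `a (Λθ)^{K−j}` (count `Λ = L⁴` times an
oscillation-type per-term size `θ^{K−j}`, no square) with `Λθ > 1`, and weights dominating `b/((K−j)+1)^p`
(couplings decaying only like a power of the number of remaining scales, times polylog radii), NO constant is a tube
budget for all `K`: for every `c` some `K` violates `TubeBudget K (w K) (s K) c` — the terms born at the first scale
alone exceed it. [folklore] -/
theorem not_tubeBudget_of_osc {w : ℕ → ℕ → ℝ} {s : ℕ → ℕ → ℕ → ℝ} {Λ θ a b : ℝ} {p : ℕ} (hΛθ : 1 < Λ * θ)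
    (ha : 0 < a) (hb : 0 < b) (hw0 : ∀ K, ∀ j ≤ K, 0 ≤ w K j)
    (hs0 : ∀ K, ∀ k ≤ K, ∀ j ≤ k, 0 ≤ s K j k)
    (hw : ∀ K, ∀ j ≤ K, b / ((((K - j : ℕ) : ℝ)) + 1) ^ p ≤ w K j)
    (hs : ∀ K, ∀ j ≤ K, a * (Λ * θ) ^ (K - j) ≤ s K j K) (c : ℝ) :
    ∃ K, ¬ TubeBudget K (w K) (s K) c := by
  obtain ⟨K, hK⟩ := exists_weight_mul_size_gt p hΛθ ha hb c
  refine ⟨K, fun hB => ?_⟩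
  have hsum := hB K le_rfl
  have hterm : b / ((K : ℝ) + 1) ^ p * (a * (Λ * θ) ^ K) ≤ w K 0 * s K 0 K := by
    have hw' := hw K 0 (Nat.zero_le K)
    have hs' := hs K 0 (Nat.zero_le K)
    simp only [Nat.sub_zero] at hw' hs'
    exact mul_le_mul hw' hs' (by positivity) (hw0 K 0 (Nat.zero_le K))
  have hle : w K 0 * s K 0 K ≤ ∑ j ∈ range (K + 1), w K j * s K j K :=
    single_le_sum (f := fun j => w K j * s K j K)
      (fun j hj => mul_nonneg (hw0 K j (Nat.lt_succ_iff.mp (mem_range.mp hj)))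
        (hs0 K K le_rfl j (Nat.lt_succ_iff.mp (mem_range.mp hj))))
      (mem_range.mpr (Nat.succ_pos K))
  linarith

/-! ## §4 Polylogarithmic radii against geometric decay -/

/-- The constant `C_q(θ) = Σ' m, (m+1)^q θ^m` (finite for `0 ≤ θ < 1`, `T4CauchySum.summable_succ_pow_mul_geometric`).
[folklore] -/
noncomputable def geomPolyConst (q : ℕ) (θ : ℝ) : ℝ :=
  ∑' m : ℕ, ((m : ℝ) + 1) ^ q * θ ^ m

/-- `0 ≤ C_q(θ)` for `θ ≥ 0`. [folklore] -/
theorem geomPolyConst_nonneg (q : ℕ) {θ : ℝ} (hθ : 0 ≤ θ) : 0 ≤ geomPolyConst q θ :=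
  tsum_nonneg fun m => by positivity

/-- **POLYNOMIAL TIMES GEOMETRIC IS BOUNDED** (row text (b3), core): `(n+1)^q θ^n ≤ C_q(θ)` for all `n`, `0 ≤ θ < 1`.
[folklore] -/
theorem succ_pow_mul_geom_le {θ : ℝ} (hθ0 : 0 ≤ θ) (hθ1 : θ < 1) (q n : ℕ) :
    ((n : ℝ) + 1) ^ q * θ ^ n ≤ geomPolyConst q θ :=
  (T4CauchySum.summable_succ_pow_mul_geometric hθ0 hθ1 q).le_tsum n fun m _ => by positivity

/-- The bounded form with an existential constant. [folklore] -/
theorem exists_succ_pow_mul_geom_le {θ : ℝ} (hθ0 : 0 ≤ θ) (hθ1 : θ < 1) (q : ℕ) :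
    ∃ C : ℝ, 0 ≤ C ∧ ∀ n : ℕ, ((n : ℝ) + 1) ^ q * θ ^ n ≤ C :=
  ⟨geomPolyConst q θ, geomPolyConst_nonneg q hθ0, succ_pow_mul_geom_le hθ0 hθ1 q⟩

/-- **RADII WITH A POLYNOMIAL PROFILE IN THE REMAINING SCALES** (row text (b3): `sup_{j ≤ K} R_j⁴ θ^{K−j} ≤ C`): if
`0 ≤ R j ≤ A ((K−j)+1)^r` for `j ≤ K` (`A ≥ 0`) and `0 ≤ θ < 1`, then `R j ^ 4 · θ^{K−j} ≤ A⁴ · C_{4r}(θ)` for every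
`j ≤ K` — a constant independent of `K` and `j` (T4-REF-O3 V3: "R_j grows only polylogarithmically … while θ^{K−j}
decays geometrically"). [folklore] -/
theorem radius_pow_mul_geom_le {K : ℕ} {R : ℕ → ℝ} {A θ : ℝ} {r : ℕ} (hA : 0 ≤ A) (hθ0 : 0 ≤ θ) (hθ1 : θ < 1)
    (hR0 : ∀ j ≤ K, 0 ≤ R j) (hR : ∀ j ≤ K, R j ≤ A * ((((K - j : ℕ) : ℝ)) + 1) ^ r) {j : ℕ} (hj : j ≤ K) :
    R j ^ 4 * θ ^ (K - j) ≤ A ^ 4 * geomPolyConst (4 * r) θ := by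
  have h1 : R j ^ 4 ≤ (A * ((((K - j : ℕ) : ℝ)) + 1) ^ r) ^ 4 := pow_le_pow_left₀ (hR0 j hj) (hR j hj) 4
  calc R j ^ 4 * θ ^ (K - j) ≤ (A * ((((K - j : ℕ) : ℝ)) + 1) ^ r) ^ 4 * θ ^ (K - j) :=
        mul_le_mul_of_nonneg_right h1 (pow_nonneg hθ0 _)
    _ = A ^ 4 * (((((K - j : ℕ) : ℝ)) + 1) ^ (4 * r) * θ ^ (K - j)) := by ring
    _ ≤ A ^ 4 * geomPolyConst (4 * r) θ :=
        mul_le_mul_of_nonneg_left (succ_pow_mul_geom_le hθ0 hθ1 (4 * r) (K - j)) (pow_nonneg hA 4)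

/-- **THE PRINTED GROWTH OF `log g_j⁻²` ALONG THE FLOW, per step** (upper half of (0.31) of [Balaban1987RG1] in the
tree's per-step normalisation `Step.Discrete031`: `1/gs_j² ≤ 1/g² + β'(K − j)`; the same monotonicity as (2.6) p. 255 of
[Balaban1988Convergent]): `log gs_j⁻² ≤ (1/g² + β')·((K−j)+1)` for `j ≤ K`, `gs_j > 0`, `β' ≥ 0` — LINEAR in the number
of remaining scales (crudely: `log x ≤ x`).  Only the UPPER half of the hypothesis is used. [cite: Balaban1987RG1, (0.31) p.259] -/
theorem log_inv_sq_le_of_discrete031 {b β' g : ℝ} {K : ℕ} {gs : ℕ → ℝ} (h : Step.Discrete031 b β' K g gs)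
    (hβ' : 0 ≤ β') {j : ℕ} (hj : j ≤ K) (hgs : 0 < gs j) :
    Real.log ((gs j) ^ 2)⁻¹ ≤ (1 / g ^ 2 + β') * ((((K - j : ℕ) : ℝ)) + 1) := by
  have hup := (h j hj).2
  have hcast : ((K : ℝ) - j) = (((K - j : ℕ) : ℝ)) := by rw [Nat.cast_sub hj]
  rw [hcast] at hup
  have hx : 0 < ((gs j) ^ 2)⁻¹ := inv_pos.mpr (pow_pos hgs 2)
  have hlog : Real.log ((gs j) ^ 2)⁻¹ ≤ ((gs j) ^ 2)⁻¹ := (Real.log_le_sub_one_of_pos hx).trans (by linarith)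
  have hg2 : 0 ≤ 1 / g ^ 2 := by positivity
  have hn : 0 ≤ (((K - j : ℕ) : ℝ)) := Nat.cast_nonneg _
  calc Real.log ((gs j) ^ 2)⁻¹ ≤ ((gs j) ^ 2)⁻¹ := hlog
    _ = 1 / (gs j) ^ 2 := (one_div _).symm
    _ ≤ 1 / g ^ 2 + β' * (((K - j : ℕ) : ℝ)) := hup
    _ ≤ (1 / g ^ 2 + β') * ((((K - j : ℕ) : ℝ)) + 1) := by nlinarith

/-- **POLYLOGARITHMIC RADII HAVE A POLYNOMIAL PROFILE IN THE REMAINING SCALES**: radii bounded by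
`D · (log gs_j⁻²)^r` ((2.5) p. 255 of [Balaban1988Convergent] gives `R_j ≤ max(1, L (log g_j⁻²)^r)`; `D`, `r` abstract
here), couplings in `]0, 1]` obeying the upper half of `Step.Discrete031 b β' K g gs`, satisfy
`R j ≤ D (1/g² + β')^r ((K−j)+1)^r` for `j ≤ K`. [cite: Balaban1988Convergent, (2.5) p.255] -/
theorem radius_profile_of_discrete031 {b β' g D : ℝ} {K r : ℕ} {gs R : ℕ → ℝ} (h : Step.Discrete031 b β' K g gs)
    (hβ' : 0 ≤ β') (hD : 0 ≤ D) (hgs0 : ∀ j ≤ K, 0 < gs j) (hgs1 : ∀ j ≤ K, gs j ≤ 1)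
    (hR : ∀ j ≤ K, R j ≤ D * (Real.log ((gs j) ^ 2)⁻¹) ^ r) {j : ℕ} (hj : j ≤ K) :
    R j ≤ D * (1 / g ^ 2 + β') ^ r * ((((K - j : ℕ) : ℝ)) + 1) ^ r := by
  have hlog0 : 0 ≤ Real.log ((gs j) ^ 2)⁻¹ := by
    refine Real.log_nonneg ?_
    have hsq1 : (gs j) ^ 2 ≤ 1 := pow_le_one₀ (le_of_lt (hgs0 j hj)) (hgs1 j hj)
    exact (one_le_inv₀ (pow_pos (hgs0 j hj) 2)).mpr hsq1
  have hpow : (Real.log ((gs j) ^ 2)⁻¹) ^ r ≤ ((1 / g ^ 2 + β') * ((((K - j : ℕ) : ℝ)) + 1)) ^ r :=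
    pow_le_pow_left₀ hlog0 (log_inv_sq_le_of_discrete031 h hβ' hj (hgs0 j hj)) r
  calc R j ≤ D * (Real.log ((gs j) ^ 2)⁻¹) ^ r := hR j hj
    _ ≤ D * ((1 / g ^ 2 + β') * ((((K - j : ℕ) : ℝ)) + 1)) ^ r := mul_le_mul_of_nonneg_left hpow hD
    _ = D * (1 / g ^ 2 + β') ^ r * ((((K - j : ℕ) : ℝ)) + 1) ^ r := by rw [mul_pow, mul_assoc]

/-- **(b3) KEYED TO (0.31)/(2.5)** (row O4.K's plug): under the hypotheses of `radius_profile_of_discrete031`,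
nonnegative radii and `0 ≤ θ < 1`, `R j ^ 4 · θ^{K−j} ≤ (D (1/g² + β')^r)⁴ · C_{4r}(θ)` for every `j ≤ K` — uniform in
`K` and `j`; the constant depends only on the final coupling `g`, `β'`, `D`, `r`, `θ`. [folklore] -/
theorem radius_pow_mul_geom_le_of_discrete031 {b β' g D θ : ℝ} {K r : ℕ} {gs R : ℕ → ℝ}
    (h : Step.Discrete031 b β' K g gs) (hβ' : 0 ≤ β') (hD : 0 ≤ D) (hθ0 : 0 ≤ θ) (hθ1 : θ < 1)
    (hgs0 : ∀ j ≤ K, 0 < gs j) (hgs1 : ∀ j ≤ K, gs j ≤ 1) (hR0 : ∀ j ≤ K, 0 ≤ R j)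
    (hR : ∀ j ≤ K, R j ≤ D * (Real.log ((gs j) ^ 2)⁻¹) ^ r) {j : ℕ} (hj : j ≤ K) :
    R j ^ 4 * θ ^ (K - j) ≤ (D * (1 / g ^ 2 + β') ^ r) ^ 4 * geomPolyConst (4 * r) θ :=
  radius_pow_mul_geom_le (mul_nonneg hD (pow_nonneg (by positivity) r)) hθ0 hθ1 hR0
    (fun i hi => radius_profile_of_discrete031 h hβ' hD hgs0 hgs1 hR hi) hj

end Literature.MathematicalPhysics.QuantumFieldTheory.Balaban1983to89.T4TubeBudget
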